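import Literature.NumberTheory.LFunctions.WeilSemilocalQuadratic
import Literature.NumberTheory.LFunctions.WeilThreePrimeSliver
import HarnessLib

/-!
# The single-prime DELETION CLIFF of the semi-local Weil forms: the floor `−Λ(p)/√p`

Numerics of the `rh-explicit` cell (lineage E, seat cc-s2-1 gen9, 2026-08-23; HOME/cc-s2-1/gen9/struct/WALSH-E.md §4,
104 certified finite-section cells): deleting ONE prime `p` from the set `S` of all primes visible on the window
`[−c, c]` drops the bottom of the semi-local form from the ζ-pinned value `≈ 0⁺` to `−log p/√p + Δ` with `Δ ≥ 0` and
`Δ → 0` super-fast in the room `2c − log p` (e.g. `p = 7`: `−0.735484904011` in both free sectors at `c = 1.7`, `= log 7/√7`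
to `1e-11`).  This file proves the FLOOR half of that law, for every `S`, as an elementary theorem:

* `weilSemilocalQuadratic_sub_erase`: if `p ∈ S` is prime and `c < log p` (so that `p²` and every larger multiple of
  `log p` lie outside the window of `k = g ⋆ g̃`), then `Q_S(g) − Q_{S∖{p}}(g) = −(log p/√p)·(k(log p) + k(−log p))`;
* `re_weilSemilocalQuadratic_erase_ge`: hence `Re Q_{S∖{p}}(g) ≥ Re Q_S(g) − (log p/√p)‖g‖₂²` — the sliver bound
  `|k(log p) + k(−log p)| ≤ ‖g‖₂²` for `log p > c` (`norm_weilConv_weilReflect_add_neg_le`, Bombieri's Lemma 2 on a sliver);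
* `re_weilSemilocalQuadratic_erase_ge_of_weilPositivityOn`: if moreover `S` contains every prime visible on the window
  and Weil positivity holds on `C(c)`, then `Re Q_{S∖{p}}(g) ≥ −(log p/√p)‖g‖₂²`;
* `re_weilSemilocalQuadratic_two_ge_on_log5half` (UNCONDITIONAL, from the tree theorem `weilPositivityOn_log5half`):
  on `C((log 5)/2)` the `S = {∞, 2}` semi-local form satisfies `Re Q_{{2}}(g) ≥ −(log 3/√3)‖g‖₂² = −0.634…‖g‖₂²`.

Nothing here bears on RH; these are statements about truncated Weil forms.
-/

set_option linter.dupNamespace false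

noncomputable section

open Complex Filter Set MeasureTheory
open scoped Real Topology ComplexConjugate

namespace Summit.RiemannHypothesis.RiemannHypothesis.Theorems.SemilocalDeletionCliff

open Literature.NumberTheory.LFunctions

variable {g : ℝ → ℂ}

/-- Erasing `p` does not change the coefficient at prime powers of OTHER primes. -/
theorem weilSemilocalCoeff_erase_prime_pow_of_ne (S : Finset ℕ) {p q m : ℕ} (hq : q.Prime) (hm : m ≠ 0)
    (hqp : q ≠ p) : weilSemilocalCoeff (S.erase p) (q ^ m) = weilSemilocalCoeff S (q ^ m) := by
  unfold weilSemilocalCoeff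
  have hiff : (q ^ m).primeFactors ⊆ S.erase p ↔ (q ^ m).primeFactors ⊆ S := by
    rw [Nat.primeFactors_prime_pow hm hq, Finset.singleton_subset_iff, Finset.singleton_subset_iff,
      Finset.mem_erase]
    exact ⟨fun h ↦ h.2, fun h ↦ ⟨hqp, h⟩⟩
  by_cases h : (q ^ m).primeFactors ⊆ S
  · rw [if_pos h, if_pos (hiff.2 h)]
  · rw [if_neg h, if_neg (fun h' ↦ h (hiff.1 h'))]

/-- At the deleted prime itself: `Λ_S(p)/√p − Λ_{S∖p}(p)/√p = log p/√p`. -/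
theorem weilSemilocalCoeff_sub_erase_self {S : Finset ℕ} {p : ℕ} (hp : p.Prime) (hpS : p ∈ S) :
    weilSemilocalCoeff S p - weilSemilocalCoeff (S.erase p) p = Real.log p / Real.sqrt p := by
  unfold weilSemilocalCoeff
  have h1 : p.primeFactors ⊆ S := by rw [hp.primeFactors]; simpa using hpS
  have h2 : ¬ p.primeFactors ⊆ S.erase p := by
    rw [hp.primeFactors, Finset.singleton_subset_iff]; exact Finset.notMem_erase p S
  rw [if_pos h1, if_neg h2, ArithmeticFunction.vonMangoldt_apply_prime hp, sub_zero]

/-- The autocorrelation `k = g ⋆ g̃` of a test function on `[−c, c]` vanishes at every `|x| > 2c`. -/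
theorem weilConv_weilReflect_eq_zero_of_lt (hg : IsWeilTest g) {c x : ℝ} (hsupp : tsupport g ⊆ Icc (-c) c)
    (hx : 2 * c < |x|) : weilConv g (weilReflect g) x = 0 := by
  have hks := tsupport_weilConv_weilReflect_subset (a := c) hg.2 hsupp
  by_contra hne
  have hmem := hks (subset_tsupport _ (Function.mem_support.2 hne))
  rw [mem_Icc] at hmem
  have : |x| ≤ 2 * c := abs_le.2 ⟨hmem.1, hmem.2⟩
  linarith

/-- **Deleting one prime, exactly.** For `p ∈ S` prime and a test function on `[−c, c]` with `c < log p`, the only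
`p`-smooth prime power inside the window of `k = g ⋆ g̃` is `p` itself, so
`Q_S(g) − Q_{S∖{p}}(g) = −(log p/√p)·(k(log p) + k(−log p))`. -/
theorem weilSemilocalQuadratic_sub_erase (hg : IsWeilTest g) {S : Finset ℕ} {p : ℕ} (hp : p.Prime) (hpS : p ∈ S)
    {c : ℝ} (hsupp : tsupport g ⊆ Icc (-c) c) (hcp : c < Real.log p) :
    weilSemilocalQuadratic S g - weilSemilocalQuadratic (S.erase p) g =
      -((Real.log p / Real.sqrt p : ℝ) : ℂ) *
        (weilConv g (weilReflect g) (Real.log p) + weilConv g (weilReflect g) (-Real.log p)) := by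
  set k := weilConv g (weilReflect g) with hkdef
  have hk : IsWeilTest k := hg.weilConv hg.weilReflect
  -- a window index N with 2c < log (N + 1)
  obtain ⟨N, hN⟩ : ∃ N : ℕ, Real.exp (2 * c) < (N : ℝ) + 1 := by
    obtain ⟨N, hN⟩ := exists_nat_gt (Real.exp (2 * c)); exact ⟨N, by linarith⟩
  have hlogN : 2 * c < Real.log ((N : ℝ) + 1) := by
    rw [Real.lt_log_iff_exp_lt (by positivity)]; exact hN
  have hks : tsupport k ⊆ Icc (-Real.log ((N : ℝ) + 1)) (Real.log ((N : ℝ) + 1)) :=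
    (tsupport_weilConv_weilReflect_subset (a := c) hg.2 hsupp).trans
      (Icc_subset_Icc (by linarith) (by linarith))
  have hS := weilSemilocalPrimeTerm_eq_sum_of_tsupport_subset S hk.1.continuous N hks
  have hS' := weilSemilocalPrimeTerm_eq_sum_of_tsupport_subset (S.erase p) hk.1.continuous N hks
  -- the difference of the two finite prime sums is the single `n = p` term
  have hdiff : weilSemilocalPrimeTerm S k - weilSemilocalPrimeTerm (S.erase p) k =
      ((Real.log p / Real.sqrt p : ℝ) : ℂ) * (k (Real.log p) + k (-Real.log p)) := by
    rw [hS, hS', ← Finset.sum_sub_distrib]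
    have hterm : ∀ n ∈ Finset.range (N + 1), n ≠ p →
        (weilSemilocalCoeff S n : ℂ) * (k (Real.log n) + k (-Real.log n)) -
          (weilSemilocalCoeff (S.erase p) n : ℂ) * (k (Real.log n) + k (-Real.log n)) = 0 := by
      intro n _ hnp
      by_cases hpp : IsPrimePow n
      · obtain ⟨q, m, hq, hm, rfl⟩ := (isPrimePow_nat_iff _).1 hpp
        by_cases hqp : q = p
        · -- n = p ^ m with m ≥ 2: outside the window of k
          subst hqp
          have hm2 : 2 ≤ m := by
            by_contra h
            push Not at h
            interval_cases m
            exact hnp (pow_one q)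
          have hlp : 0 < Real.log q := Real.log_pos (by exact_mod_cast hq.one_lt)
          have hlog : 2 * c < |Real.log ((q ^ m : ℕ) : ℝ)| := by
            push_cast
            rw [Real.log_pow, abs_of_nonneg (by positivity)]
            have : (2 : ℝ) * Real.log q ≤ m * Real.log q :=
              mul_le_mul_of_nonneg_right (by exact_mod_cast hm2) hlp.le
            linarith
          have h1 : k (Real.log ((q ^ m : ℕ) : ℝ)) = 0 := weilConv_weilReflect_eq_zero_of_lt hg hsupp hlog
          have h2 : k (-Real.log ((q ^ m : ℕ) : ℝ)) = 0 :=
            weilConv_weilReflect_eq_zero_of_lt hg hsupp (by rwa [abs_neg])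
          rw [h1, h2]; ring
        · rw [weilSemilocalCoeff_erase_prime_pow_of_ne S hq hm.ne' hqp]; ring
      · rw [weilSemilocalCoeff_of_not_isPrimePow S hpp, weilSemilocalCoeff_of_not_isPrimePow (S.erase p) hpp]; ring
    rw [Finset.sum_eq_single p hterm]
    · rw [← sub_mul, ← Complex.ofReal_sub, weilSemilocalCoeff_sub_erase_self hp hpS]
    · -- p outside the range: then log p ≥ log (N+1) > 2c and both k-values vanish
      intro hpn
      rw [Finset.mem_range, not_lt] at hpn
      have hlog : 2 * c < |Real.log (p : ℝ)| := by
        have : Real.log ((N : ℝ) + 1) ≤ Real.log p :=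
          Real.log_le_log (by positivity) (by exact_mod_cast hpn)
        rw [abs_of_nonneg (Real.log_nonneg (by exact_mod_cast hp.one_lt.le))]; linarith
      have h1 : k (Real.log p) = 0 := weilConv_weilReflect_eq_zero_of_lt hg hsupp hlog
      have h2 : k (-Real.log p) = 0 := weilConv_weilReflect_eq_zero_of_lt hg hsupp (by rwa [abs_neg])
      rw [h1, h2]
      ring
  unfold weilSemilocalQuadratic weilSemilocalFunctional
  rw [← hkdef]
  linear_combination (-1 : ℂ) * hdiff

/-- **The deletion cliff floor.** `Re Q_{S∖{p}}(g) ≥ Re Q_S(g) − (log p/√p)·‖g‖₂²` whenever `p ∈ S` is prime and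
`tsupport g ⊆ [−c, c]` with `c < log p`. -/
theorem re_weilSemilocalQuadratic_erase_ge (hg : IsWeilTest g) {S : Finset ℕ} {p : ℕ} (hp : p.Prime) (hpS : p ∈ S)
    {c : ℝ} (hsupp : tsupport g ⊆ Icc (-c) c) (hcp : c < Real.log p) :
    (weilSemilocalQuadratic S g).re - Real.log p / Real.sqrt p * ∫ u : ℝ, ‖g u‖ ^ 2 ≤
      (weilSemilocalQuadratic (S.erase p) g).re := by
  have h := weilSemilocalQuadratic_sub_erase hg hp hpS hsupp hcp
  have hsl := norm_weilConv_weilReflect_add_neg_le hg hsupp hcp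
  have hw : 0 ≤ Real.log p / Real.sqrt p :=
    div_nonneg (Real.log_nonneg (by exact_mod_cast hp.one_lt.le)) (Real.sqrt_nonneg _)
  have heq : (weilSemilocalQuadratic (S.erase p) g).re = (weilSemilocalQuadratic S g).re +
      Real.log p / Real.sqrt p *
        (weilConv g (weilReflect g) (Real.log p) + weilConv g (weilReflect g) (-Real.log p)).re := by
    have : weilSemilocalQuadratic (S.erase p) g = weilSemilocalQuadratic S g +
        ((Real.log p / Real.sqrt p : ℝ) : ℂ) *
          (weilConv g (weilReflect g) (Real.log p) + weilConv g (weilReflect g) (-Real.log p)) := by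
      linear_combination (-1 : ℂ) * h
    rw [this, Complex.add_re, Complex.re_ofReal_mul]
  rw [heq]
  have hre : -(∫ u : ℝ, ‖g u‖ ^ 2) ≤
      (weilConv g (weilReflect g) (Real.log p) + weilConv g (weilReflect g) (-Real.log p)).re := by
    have := (abs_re_le_norm _).trans hsl
    exact (abs_le.1 this).1
  nlinarith

/-- **The floor under Weil positivity.** If `S` contains every prime visible on the window `C(c)`,
`c ≤ (log (N+1))/2`, and Weil positivity holds on `C(c)`, then deleting a prime `p ∈ S` with `log p > c`
leaves `Re Q_{S∖{p}}(g) ≥ −(log p/√p)‖g‖₂²`. -/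
theorem re_weilSemilocalQuadratic_erase_ge_of_weilPositivityOn (hg : IsWeilTest g) {S : Finset ℕ} {N p : ℕ}
    (hS : ∀ n ≤ N, IsPrimePow n → n.primeFactors ⊆ S) (hp : p.Prime) (hpS : p ∈ S) {c : ℝ}
    (hcN : c ≤ Real.log ((N : ℝ) + 1) / 2) (hpos : WeilPositivityOn c)
    (hsupp : tsupport g ⊆ Icc (-c) c) (hcp : c < Real.log p) :
    -(Real.log p / Real.sqrt p * ∫ u : ℝ, ‖g u‖ ^ 2) ≤ (weilSemilocalQuadratic (S.erase p) g).re := by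
  have h1 := re_weilSemilocalQuadratic_erase_ge hg hp hpS hsupp hcp
  have hfull : weilSemilocalQuadratic S g = weilQuadratic g :=
    weilSemilocalQuadratic_eq_weilQuadratic_of_forall hg hS (hsupp.trans (Icc_subset_Icc (by linarith) hcN))
  have h0 : 0 ≤ (weilSemilocalQuadratic S g).re := by rw [hfull]; exact hpos g hg hsupp
  linarith

end Summit.RiemannHypothesis.RiemannHypothesis.Theorems.SemilocalDeletionCliff

end
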